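import Mathlib
import Summits.ResolutionOfSingularities.ResolutionOfSingularities.Theorems.RadicialJungCleanModelsCleanLU3ArcSequence
import Literature.AlgebraicGeometry.Resolution.RsopMonomialIdeals
import HarnessLib

/-!
# Route `RadicialJung`, crux `CleanModels` (stmt-15917), stub `stub_cleanLU3Defect`, class (A) «arcs»: THE CORE — along an arc, a
# `p`-th-power approximation of `h` becomes a regular PARAMETER after finitely many quadratic transforms

Line `Sketch` rev 18 of crux stmt-ResolutionOfSingularities-15917, memo `Cruxes/CleanModels/Lines/Sketch-memo-defect-residue.md` §3; lead
`res-B-lead-1` g2.  OURS; nothing here proves resolution in characteristic `p`.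

Ring-level core of the arc case of clean local uniformization (`arc_core`): `R₀ → R₁ → ⋯` the quadratic sequence along a valuation ring
`O` with a value-generator `π`, all `Rᵢ` regular of dimension `3`, arc coordinates `(π, u, w)` of `R₀` to depth `M`, `E = s·D` a
derivation-multiple preserving `R₀` with `v (E h) = v π ^ o_D`, and `c ∈ R₀` with `v (h - c^p) ≤ v π ^ M` (`M ≥ 2 o_D + p + 2`).  Then for
some `n ≤ M - 1` and `m'` with `p m' = n + o` (`o ≤ o_D` the transversal order of `h` along the arc), the element
`G = (h - c^p)/π^{p m'}` lies in `𝔪_{Rₙ} ∖ 𝔪_{Rₙ}²`: a representative of the `K^p`-line of `h` of loose clean form (3) at `Rₙ`.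
Mechanism: the kernel lemma writes `h - c^p = uA + wB + π^M C`; the derivative bounds the order `o` of `(A, B)` modulo `(u, w)`; at level
`n` the arc coordinates `u = πⁿ uₙ, w = πⁿ wₙ` turn `h - c^p` into `π^{n+o}(a uₙ + b wₙ + …)` with `a` or `b` a unit.
-/

noncomputable section

set_option linter.dupNamespace false -- mandated namespace of this single-conjunct summit

open IsLocalRing
open Literature.AlgebraicGeometry.Resolution

namespace Summit.ResolutionOfSingularities.ResolutionOfSingularities.Theorems.RadicialJung.CleanModels

variable {K : Type} [Field K]

/-- Elements of `(u, w, π^j)` have value `≤ v π ^ j` when `v u, v w ≤ v π ^ j` and the ring lies in `O`. [folklore] -/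
theorem valuation_le_of_mem_span {O : ValuationSubring K} {R : Subring K} (hRO : R ≤ O.toSubring) (π u w : R) (j : ℕ)
    (hu : O.valuation (u : K) ≤ O.valuation (π : K) ^ j) (hw : O.valuation (w : K) ≤ O.valuation (π : K) ^ j)
    (y : R) (hy : y ∈ Ideal.span {u, w, π ^ j}) : O.valuation (y : K) ≤ O.valuation (π : K) ^ j := by
  obtain ⟨α, β, γ, rfl⟩ := (mem_span_triple_iff u w (π ^ j) y).mp hy
  have hle1 : ∀ a : R, O.valuation (a : K) ≤ 1 := fun a => (O.valuation_le_one_iff _).mpr (hRO a.2)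
  push_cast
  refine (Valuation.map_add _ _ _).trans (max_le ((Valuation.map_add _ _ _).trans (max_le ?_ ?_)) ?_)
  · rw [map_mul]; exact (mul_le_mul' (hle1 α) hu).trans_eq (one_mul _)
  · rw [map_mul]; exact (mul_le_mul' (hle1 β) hw).trans_eq (one_mul _)
  · rw [map_mul, map_pow]; exact (mul_le_mul' (hle1 γ) le_rfl).trans_eq (one_mul _)

/-- In a regular local ring of dimension `3` whose maximal ideal is `(x, y, z)`, a combination `a y + b z` with `a` a unit is not
in `𝔪²`. [folklore] -/
theorem not_mem_sq_of_unit_coeff {S : Type*} [CommRing S] [IsRegularLocalRing S] (hdim : ringKrullDim S = 3) (x y z : S)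
    (hm : maximalIdeal S = Ideal.span {x, y, z}) (a b : S) (ha : IsUnit a) : a * y + b * z ∉ maximalIdeal S ^ 2 := by
  classical
  obtain ⟨a', rfl⟩ := ha
  intro hmem
  -- `t = y + a⁻¹ b z` is part of a regular system of parameters
  set t : S := y + (↑a'⁻¹ : S) * b * z with htdef
  have ht2 : t ∈ maximalIdeal S ^ 2 := by
    have : t = (↑a'⁻¹ : S) * ((a' : S) * y + b * z) := by
      rw [htdef, mul_add, ← mul_assoc, Units.inv_mul, one_mul]; ring
    rw [this]; exact Ideal.mul_mem_left _ _ hmem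
  have hspan : Ideal.span (Set.range ![x, t, z]) = maximalIdeal S := by
    have hr : Set.range ![x, t, z] = {x, t, z} := by
      ext s
      simp only [Set.mem_range, Set.mem_insert_iff, Set.mem_singleton_iff]
      constructor
      · rintro ⟨i, rfl⟩; fin_cases i <;> simp
      · rintro (rfl | rfl | rfl)
        exacts [⟨0, rfl⟩, ⟨1, rfl⟩, ⟨2, rfl⟩]
    rw [hr, hm]
    apply le_antisymm
    · rw [Ideal.span_le]
      rintro s (rfl | rfl | rfl)
      · exact Ideal.subset_span (by simp)
      · exact Ideal.add_mem _ (Ideal.subset_span (by simp)) (Ideal.mul_mem_left _ _ (Ideal.subset_span (by simp)))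
      · exact Ideal.subset_span (by simp)
    · rw [Ideal.span_le]
      rintro s (rfl | rfl | rfl)
      · exact Ideal.subset_span (by simp)
      · have : s = t - (↑a'⁻¹ : S) * b * z := by rw [htdef]; ring
        rw [this]
        exact Ideal.sub_mem _ (Ideal.subset_span (by simp)) (Ideal.mul_mem_left _ _ (Ideal.subset_span (by simp)))
      · exact Ideal.subset_span (by simp)
  have hd : (maximalIdeal S).spanFinrank = 3 := by
    have h := IsRegularLocalRing.spanFinrank_maximalIdeal (R := S)
    rw [hdim] at h; exact_mod_cast h
  have hrsop : IsRsopPart (![x, t, z]) := isRsopPart_comp_of_rsop hd (![x, t, z]) hspan id Function.injective_id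
  exact hrsop.not_mem_sq 1 ht2

/-- **Arc core.** See the module docstring. [folklore] -/
theorem arc_core {O : ValuationSubring K} {p : ℕ} [hp : Fact p.Prime] [CharP K p]
    (R : ℕ → Subring K) [hR : ∀ i, IsLocalRing (R i)] (hreg : ∀ i, IsRegularLocalRing (R i))
    (hdim : ∀ i, ringKrullDim (R i) = 3)
    (h0 : SubringDominates (R 0) O.toSubring) (hstep : ∀ i, IsQuadraticTransformAlong O (R i) (R (i + 1)))
    (π u w : K) (hπR : π ∈ R 0) (huR : u ∈ R 0) (hwR : w ∈ R 0)
    (hm : maximalIdeal (R 0) = Ideal.span {(⟨π, hπR⟩ : R 0), ⟨u, huR⟩, ⟨w, hwR⟩}) (hπ0 : π ≠ 0)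
    (hπ : ∀ x : K, O.valuation x < 1 → O.valuation x ≤ O.valuation π)
    (D : Derivation ℤ K K) (s : K) (hD : ∀ y ∈ R 0, s * D y ∈ R 0)
    (h c : K) (hh : h ∈ R 0) (hc : c ∈ R 0) (oD M : ℕ) (hoD : O.valuation (s * D h) = O.valuation π ^ oD)
    (hM : 2 * oD + p + 2 ≤ M)
    (hu : O.valuation u ≤ O.valuation π ^ M) (hw : O.valuation w ≤ O.valuation π ^ M)
    (hprec : O.valuation (h - c ^ p) ≤ O.valuation π ^ M) :
    ∃ (n m' : ℕ), n + 1 ≤ M ∧ ∃ G : R n, G ∈ maximalIdeal (R n) ∧ G ∉ maximalIdeal (R n) ^ 2 ∧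
      (G : K) = (h - c ^ p) / π ^ (p * m') := by
  classical
  have hRO : R 0 ≤ O.toSubring := h0.1
  have hmem0 : ∀ a : R 0, a ∈ maximalIdeal (R 0) ↔ O.valuation (a : K) < 1 := (subringDominates_valuationSubring_iff hRO).mp h0
  have hvπ : O.valuation π < 1 := (hmem0 ⟨π, hπR⟩).mp (by rw [hm]; exact Ideal.subset_span (by simp))
  have hvπpos : 0 < O.valuation π := zero_lt_iff.mpr ((Valuation.ne_zero_iff _).mpr hπ0)
  have hanti : ∀ {i j : ℕ}, i ≤ j → O.valuation π ^ j ≤ O.valuation π ^ i := fun hij =>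
    pow_le_pow_right_of_le_one' hvπ.le hij
  -- notation for the generators in `R 0`
  set Pe : R 0 := ⟨π, hπR⟩ with hPe
  set U : R 0 := ⟨u, huR⟩ with hU
  set W : R 0 := ⟨w, hwR⟩ with hW
  -- (1) the kernel lemma: `h - c^p = u A + w B + π^M C`
  have hy₀ : (⟨h - c ^ p, (R 0).sub_mem hh ((R 0).pow_mem hc p)⟩ : R 0) ∈ Ideal.span {U, W, Pe ^ M} :=
    mem_span_of_valuation_le h0 Pe U W hm hπ0 hu hw le_rfl _ hprec
  obtain ⟨A, B, C, hABC⟩ := (mem_span_triple_iff U W (Pe ^ M) _).mp hy₀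
  have hABC' : h - c ^ p = u * (A : K) + w * (B : K) + π ^ M * (C : K) := by
    have := congrArg (fun t : R 0 => (t : K)) hABC
    simp only [Subring.coe_add, Subring.coe_mul, Subring.coe_pow] at this
    rw [this]; ring
  -- (2) the derivative: `E = s D` kills `p`-th powers and bounds the order of `(A, B)`
  have hEleib : ∀ a b : K, s * D (a * b) = a * (s * D b) + b * (s * D a) := fun a b => by
    rw [Derivation.leibniz, smul_eq_mul, smul_eq_mul]; ring
  have hEcp : s * D (c ^ p) = 0 := by
    rw [Derivation.leibniz_pow]
    simp [smul_eq_mul, nsmul_eq_mul]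
  have hEπM : s * D (π ^ M) = (M : K) * π ^ (M - 1) * (s * D π) := by
    rw [Derivation.leibniz_pow]
    simp only [nsmul_eq_mul, smul_eq_mul]
    ring
  let I : ℕ → Ideal (R 0) := fun j => Ideal.span {U, W, Pe ^ j}
  have hIanti : ∀ {i j : ℕ}, i ≤ j → I j ≤ I i := by
    intro i j hij
    change Ideal.span _ ≤ Ideal.span _
    rw [Ideal.span_le]
    rintro t ht
    simp only [Set.mem_insert_iff, Set.mem_singleton_iff] at ht
    rcases ht with rfl | rfl | rfl
    · exact Ideal.subset_span (by simp)
    · exact Ideal.subset_span (by simp)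
    · obtain ⟨k, rfl⟩ := Nat.exists_eq_add_of_le hij
      rw [pow_add]; exact Ideal.mul_mem_right _ _ (Ideal.subset_span (by simp))
  let P : ℕ → Prop := fun j => A ∈ I j ∧ B ∈ I j
  have hP0 : P 0 := by
    have htop : I 0 = ⊤ := by
      change Ideal.span _ = ⊤
      rw [pow_zero]; exact Ideal.eq_top_of_isUnit_mem _ (Ideal.subset_span (by simp)) isUnit_one
    exact ⟨by rw [htop]; trivial, by rw [htop]; trivial⟩
  have hnot : ¬ P (oD + 1) := by
    rintro ⟨hA, hB⟩
    -- `s D h ∈ I (oD + 1)`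
    have hEh_mem : s * D h ∈ R 0 := hD h hh
    have key : (⟨s * D h, hEh_mem⟩ : R 0) ∈ I (oD + 1) := by
      have hle : oD + 1 ≤ M - 1 := by omega
      have hle' : oD + 1 ≤ M := by omega
      -- the pieces
      let EA : R 0 := ⟨s * D (A : K), hD _ A.2⟩
      let EB : R 0 := ⟨s * D (B : K), hD _ B.2⟩
      let EC : R 0 := ⟨s * D (C : K), hD _ C.2⟩
      let EU : R 0 := ⟨s * D u, hD _ huR⟩
      let EW : R 0 := ⟨s * D w, hD _ hwR⟩
      let EPe : R 0 := ⟨s * D π, hD _ hπR⟩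
      have hsum : (⟨s * D h, hEh_mem⟩ : R 0) =
          (U * EA + A * EU) + (W * EB + B * EW) + (Pe ^ M * EC + C * ((M : R 0) * Pe ^ (M - 1) * EPe)) := by
        apply Subtype.ext
        change s * D h = (u * (s * D (A : K)) + (A : K) * (s * D u)) + (w * (s * D (B : K)) + (B : K) * (s * D w)) +
          (π ^ M * (s * D (C : K)) + (C : K) * ((M : K) * π ^ (M - 1) * (s * D π)))
        have : h = c ^ p + (u * (A : K) + w * (B : K) + π ^ M * (C : K)) := by rw [← hABC']; ring
        rw [this, map_add, mul_add, hEcp, zero_add, map_add, mul_add, map_add, mul_add, hEleib, hEleib, hEleib, hEπM]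
      rw [hsum]
      refine Ideal.add_mem _ (Ideal.add_mem _ (Ideal.add_mem _ ?_ ?_) (Ideal.add_mem _ ?_ ?_)) (Ideal.add_mem _ ?_ ?_)
      · exact Ideal.mul_mem_right _ _ (Ideal.subset_span (by simp))
      · exact Ideal.mul_mem_right _ _ hA
      · exact Ideal.mul_mem_right _ _ (Ideal.subset_span (by simp))
      · exact Ideal.mul_mem_right _ _ hB
      · exact Ideal.mul_mem_right _ _ (hIanti hle' (Ideal.subset_span (by simp)))
      · exact Ideal.mul_mem_left _ _ (Ideal.mul_mem_right _ _ (Ideal.mul_mem_left _ _ (hIanti hle (Ideal.subset_span (by simp)))))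
    have hval := valuation_le_of_mem_span hRO Pe U W (oD + 1) (hu.trans (hanti (by omega))) (hw.trans (hanti (by omega))) _ key
    change O.valuation (s * D h) ≤ O.valuation π ^ (oD + 1) at hval
    rw [hoD, pow_succ] at hval
    have : O.valuation π ^ oD * 1 ≤ O.valuation π ^ oD * O.valuation π := by rwa [mul_one]
    exact absurd (le_of_mul_le_mul_left this (pow_pos hvπpos oD)) (not_le.mpr hvπ)
  -- (3) the order `o`
  have hex : ∃ j, ¬ P (j + 1) := ⟨oD, hnot⟩
  let o := Nat.find hex
  have ho : ¬ P (o + 1) := Nat.find_spec hex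
  have ho_le : o ≤ oD := Nat.find_le hnot
  have hPo : P o := by
    rcases Nat.eq_zero_or_pos o with h0' | hpos
    · rw [h0']; exact hP0
    · obtain ⟨j, hj⟩ := Nat.exists_eq_add_one_of_ne_zero hpos.ne'
      have hmin : ¬ ¬ P (j + 1) := Nat.find_min hex (by omega)
      rw [hj]; exact not_not.mp hmin
  obtain ⟨hAo, hBo⟩ := hPo
  obtain ⟨α, β, a, hA⟩ := (mem_span_triple_iff U W (Pe ^ o) A).mp hAo
  obtain ⟨α', β', b, hB⟩ := (mem_span_triple_iff U W (Pe ^ o) B).mp hBo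
  -- `a` or `b` is a unit
  have hunit : IsUnit a ∨ IsUnit b := by
    by_contra hcon
    push Not at hcon
    obtain ⟨ha, hb⟩ := hcon
    have hlift : ∀ (X γ δ e : R 0), X = γ * U + δ * W + e * Pe ^ o → ¬ IsUnit e → X ∈ I (o + 1) := by
      intro X γ δ e hX he
      have hem : e ∈ maximalIdeal (R 0) := he
      rw [hm] at hem
      obtain ⟨e₁, e₂, e₃, rfl⟩ := (mem_span_triple_iff Pe U W e).mp hem
      rw [hX, mem_span_triple_iff]
      exact ⟨γ + e₂ * Pe ^ o, δ + e₃ * Pe ^ o, e₁, by ring⟩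
    exact ho ⟨hlift A α β a hA ha, hlift B α' β' b hB hb⟩
  -- (4) the level `n`
  set q : ℕ := 2 * o / p with hq
  set r : ℕ := 2 * o % p with hr
  have h1 : p * q + r = 2 * o := Nat.div_add_mod (2 * o) p
  have h2 : r < p := Nat.mod_lt (2 * o) hp.out.pos
  let m' : ℕ := q + 1
  have hpm'eq : p * m' = p * q + p := by simp only [m']; ring
  have hpm' : 2 * o ≤ p * m' ∧ p * m' ≤ 2 * o + p := by rw [hpm'eq]; constructor <;> omega
  let n : ℕ := p * m' - o
  have hno : n + o = p * m' := Nat.sub_add_cancel (by omega)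
  have hn_ge : o ≤ n := by omega
  have hnM : n + 1 ≤ M := by omega
  have he₂ : 2 ≤ M - (n + o) := by omega
  -- (5) arc coordinates at level `n`
  obtain ⟨hπn, hun, hwn, hmn⟩ := maximalIdeal_quadraticSeq_arc R h0 hstep π u w hπR huR hwR hm hπ0 hπ hu hw n hnM
  haveI := hreg n
  have hmono : R 0 ≤ R n := sequence_monotone hstep (Nat.zero_le n)
  set Pen : R n := ⟨π, hπn⟩ with hPen'
  set Un : R n := ⟨u / π ^ n, hun⟩
  set Wn : R n := ⟨w / π ^ n, hwn⟩
  let ι : R 0 →+* R n := Subring.inclusion hmono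
  have hι : ∀ t : R 0, ((ι t : R n) : K) = (t : K) := fun t => rfl
  -- (6) the element `G`
  let Q : R n := ι α * Un ^ 2 + (ι β + ι α') * Un * Wn + ι β' * Wn ^ 2
  let Gn : R n := ι a * Un + ι b * Wn + Pen ^ (n - o) * Q + Pen ^ (M - (n + o)) * ι C
  have hGK : (Gn : K) * π ^ (n + o) = h - c ^ p := by
    have hπn0 : π ^ n ≠ 0 := pow_ne_zero _ hπ0
    have hA' : (A : K) = (α : K) * u + (β : K) * w + (a : K) * π ^ o := by
      have := congrArg (fun t : R 0 => (t : K)) hA; simpa using this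
    have hB' : (B : K) = (α' : K) * u + (β' : K) * w + (b : K) * π ^ o := by
      have := congrArg (fun t : R 0 => (t : K)) hB; simpa using this
    have en : π ^ n = π ^ (n - o) * π ^ o := by rw [← pow_add]; congr 1; omega
    have eM : π ^ M = π ^ (n - o) * π ^ o * π ^ o * π ^ (M - (n + o)) := by
      rw [← pow_add, ← pow_add, ← pow_add]; congr 1; omega
    have eno : π ^ (n + o) = π ^ (n - o) * π ^ o * π ^ o := by rw [← pow_add, ← pow_add]; congr 1; omega
    set un : K := u / π ^ n with hun'
    set wn : K := w / π ^ n with hwn'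
    have hu' : u = π ^ n * un := by rw [hun', mul_div_cancel₀ _ hπn0]
    have hw' : w = π ^ n * wn := by rw [hwn', mul_div_cancel₀ _ hπn0]
    have hGn : (Gn : K) = (a : K) * un + (b : K) * wn + π ^ (n - o) * ((α : K) * un ^ 2 + ((β : K) + (α' : K)) * un * wn +
        (β' : K) * wn ^ 2) + π ^ (M - (n + o)) * (C : K) := by
      simp only [Gn, Q, Subring.coe_add, Subring.coe_mul, Subring.coe_pow, hι]
      rfl
    rw [hGn, hABC', hA', hB', eM, eno, hu', hw', en]
    ring
  have hπpow0 : π ^ (n + o) ≠ 0 := pow_ne_zero _ hπ0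
  refine ⟨n, m', hnM, Gn, ?_, ?_, ?_⟩
  · -- `G ∈ 𝔪`
    rw [hmn]
    have hUn : Un ∈ Ideal.span ({Pen, Un, Wn} : Set (R n)) := Ideal.subset_span (by simp)
    have hWn : Wn ∈ Ideal.span ({Pen, Un, Wn} : Set (R n)) := Ideal.subset_span (by simp)
    have hPen : Pen ∈ Ideal.span ({Pen, Un, Wn} : Set (R n)) := Ideal.subset_span (by simp)
    have hQ : Q ∈ Ideal.span ({Pen, Un, Wn} : Set (R n)) := by
      refine Ideal.add_mem _ (Ideal.add_mem _ ?_ ?_) ?_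
      · rw [pow_two, ← mul_assoc]; exact Ideal.mul_mem_left _ _ hUn
      · exact Ideal.mul_mem_left _ _ hWn
      · rw [pow_two, ← mul_assoc]; exact Ideal.mul_mem_left _ _ hWn
    refine Ideal.add_mem _ (Ideal.add_mem _ (Ideal.add_mem _ (Ideal.mul_mem_left _ _ hUn) (Ideal.mul_mem_left _ _ hWn))
      (Ideal.mul_mem_left _ _ hQ)) (Ideal.mul_mem_right _ _ (Ideal.pow_mem_of_mem _ hPen _ (by omega)))
  · -- `G ∉ 𝔪²`
    intro hG2
    have hUm : Un ∈ maximalIdeal (R n) := by rw [hmn]; exact Ideal.subset_span (by simp)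
    have hWm : Wn ∈ maximalIdeal (R n) := by rw [hmn]; exact Ideal.subset_span (by simp)
    have hPm : Pen ∈ maximalIdeal (R n) := by rw [hmn]; exact Ideal.subset_span (by simp)
    have hQ2 : Q ∈ maximalIdeal (R n) ^ 2 := by
      refine Ideal.add_mem _ (Ideal.add_mem _ ?_ ?_) ?_
      · exact Ideal.mul_mem_left _ _ (Ideal.pow_mem_pow hUm 2)
      · rw [mul_assoc, pow_two]; exact Ideal.mul_mem_left _ _ (Ideal.mul_mem_mul hUm hWm)
      · exact Ideal.mul_mem_left _ _ (Ideal.pow_mem_pow hWm 2)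
    have hP2 : Pen ^ (M - (n + o)) ∈ maximalIdeal (R n) ^ 2 :=
      Ideal.pow_le_pow_right he₂ (Ideal.pow_mem_pow hPm _)
    have hL : ι a * Un + ι b * Wn ∈ maximalIdeal (R n) ^ 2 := by
      have : ι a * Un + ι b * Wn = Gn - Pen ^ (n - o) * Q - Pen ^ (M - (n + o)) * ι C := by
        simp only [Gn]; ring
      rw [this]
      exact Ideal.sub_mem _ (Ideal.sub_mem _ hG2 (Ideal.mul_mem_left _ _ hQ2)) (Ideal.mul_mem_right _ _ hP2)
    rcases hunit with ha | hb
    · exact not_mem_sq_of_unit_coeff (hdim n) Pen Un Wn hmn (ι a) (ι b) (ha.map ι) hL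
    · have hmn' : maximalIdeal (R n) = Ideal.span {Pen, Wn, Un} := by
        rw [hmn, Set.pair_comm Un Wn]
      rw [add_comm] at hL
      exact not_mem_sq_of_unit_coeff (hdim n) Pen Wn Un hmn' (ι b) (ι a) (hb.map ι) hL
  · -- the equation
    rw [← hno, ← hGK, mul_div_cancel_right₀ _ hπpow0]

end Summit.ResolutionOfSingularities.ResolutionOfSingularities.Theorems.RadicialJung.CleanModels

end
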